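import Summits.CriticalPhenomena.SAWScalingLimit.Theses.SAWLoopFugacityFlow
import Summits.CriticalPhenomena.SAWScalingLimit.Theorems.IsingBoundaryRatio.Negative.IsingBoundaryRatioNormalisation
import Summits.CriticalPhenomena.SAWScalingLimit.Theorems.SAWLoopFugacityFlowIsingBoundaryRatioRestrictionMapAtZero
import Summits.CriticalPhenomena.SAWScalingLimit.Theorems.SAWLoopFugacityFlowIsingBoundaryRatioRestrictionMapAtInfty
import Summits.CriticalPhenomena.SAWScalingLimit.Theorems.SAWLoopFugacityFlowIsingBoundaryRatioBoundaryFusion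
import Summits.CriticalPhenomena.SAWScalingLimit.Theorems.SAWLoopFugacityFlowIsingBoundaryRatioBulkFreeRatio
import HarnessLib

/-!
# Crux `IsingBoundaryRatio` (stmt-CriticalPhenomena-10650), line `fk-anchor-transfer`:
the residual lattice statement `AnchorTransfer` is crux-EQUIVALENT modulo CHI's printed theorem

The line `fk-anchor-transfer` (skeleton `Cruxes/IsingBoundaryRatio/Lines/fk_anchor_transfer.lean`,
rev 4) closes the crux from two inputs: the printed named fact
`Literature.Probability.LatticeModels.chi_twoPoint_free_jordan` (CHI15 Thm 1.1, free boundary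
conditions; through the landed `bulkFreeRatio_of_chi`) and ONE unprinted lattice statement,
**anchor transfer**: for the hull subdomain `D' ⊆ D` agreeing with `D` near the marked points and an
endpoint approximation `(a_δ, b_δ)` of `D'`, the crux's nested ratio
`⟨σ_{a_δ}σ_{b_δ}⟩_{Ω'_δ}/⟨σ_{a_δ}σ_{b_δ}⟩_{Ω_δ}` is eventually within `η` of the nested ratio
`⟨σ_{[z/δ]}σ_{[w/δ]}⟩_{Ω'_δ}/⟨σ_{[z/δ]}σ_{[w/δ]}⟩_{Ω_δ}` at the rounded sites of any two bulk points
`z, w ∈ D'` that are `r(η)`-close to `a, b` (`T = Negative.T`, the landed normal form of the crux's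
inline free critical two-point function).

This file proves, sorry-free:

* `normalForm_of_anchorTransfer'` — anchor transfer + bulk free ratio + boundary fusion ⇒ the crux's
  normal form (the `3η` argument of the skeleton, restated over landed declarations only);
* `anchorTransfer_of_normalForm'` — CONVERSELY, bulk free ratio + boundary fusion + the normal form
  ⇒ anchor transfer: conformal data `(φ, A, Φ, d)` for the pair exist by tree theorems
  (`MarkedDomain.exists_isChordalUniformizing_holds`, `IsStarHull.pullbackHull`,
  `IsStarHull.existsUnique_isRestrictionMap_holds`, `IsStarHull.exists_hasRestrictionDeriv_holds`),
  boundary fusion gives a uniform radius, and the two lattice limits are compared through `d^{1/2}`;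
* `isingBoundaryRatio_iff_anchorTransfer` — hence, given the printed fact X,
  `IsingBoundaryRatio ↔ AnchorTransfer` (boundary fusion is the landed theorem
  `stub_boundaryFusionCore stub_restrictionMapAtZero (stub_restrictionMapAtInfty …)`).

So the registered stub `stub_anchorTransfer` of the line is not merely sufficient but exactly the
unprinted content of the crux: no strictly weaker lattice statement closes this line, and a
promotion of the stub re-files the crux minus CHI's theorem.
-/

noncomputable section

open scoped Classical Topology
open MeasureTheory Filter Set Function Metric
open Literature.Probability.LatticeModels Literature.Probability.RandomPlanarGeometry
open UpperHalfPlane (upperHalfPlaneSet)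

namespace Summit.CriticalPhenomena.SAWScalingLimit.Theorems.IsingBoundaryRatio

open Summit.CriticalPhenomena.SAWScalingLimit.Theorems.IsingBoundaryRatio.Negative
open Summit.CriticalPhenomena.SAWScalingLimit.Theses.SAWLoopFugacityFlow (IsingBoundaryRatio)

/-- **Anchor transfer + bulk free ratio + boundary fusion ⇒ the crux's normal form** (the skeleton's
`normalForm_of_transfer`, over landed declarations): given `e`, take `r` from anchor transfer and
bulk points `(z, w)` — the product filter `𝓝[D'] a ×ˢ 𝓝[D'] b` is non-trivial since
`a, b ∈ ∂D' ⊆ closure D'` — with the continuum ratio within `e/3` of `d^{1/2}`; the bulk lattice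
ratio at `(z, w)` is eventually within `e/3` of the continuum ratio. -/
theorem normalForm_of_anchorTransfer'
    (hK1 : ∀ (D D' : DobrushinDomain) (a b : ℝ → Site 2), SAW.IsEndpointApprox D a b →
      SAW.IsEndpointApprox D' a b → D'.carrier ⊆ D.carrier →
      (∃ ε : ℝ, 0 < ε ∧ D'.carrier ∩ Metric.ball (D.pt 0) ε = D.carrier ∩ Metric.ball (D.pt 0) ε ∧
        D'.carrier ∩ Metric.ball (D.pt 1) ε = D.carrier ∩ Metric.ball (D.pt 1) ε) →
      ∀ η : ℝ, 0 < η → ∃ r : ℝ, 0 < r ∧ ∀ z w : ℂ, z ∈ D'.carrier → w ∈ D'.carrier →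
        dist z (D.pt 0) < r → dist w (D.pt 1) < r →
        ∀ᶠ δ in 𝓝[>] (0 : ℝ),
          |T D'.carrier δ (a δ) (b δ) / T D.carrier δ (a δ) (b δ) -
            T D'.carrier δ (nearestSite δ z) (nearestSite δ w) /
              T D.carrier δ (nearestSite δ z) (nearestSite δ w)| < η)
    (hK2 : ∀ (D D' : DobrushinDomain), D'.carrier ⊆ D.carrier →
      ∀ (φ : ConformalEquiv upperHalfPlaneSet D.carrier) (A : Set ℂ),
        A = closure (upperHalfPlaneSet \ {z | z ∈ upperHalfPlaneSet ∧ φ z ∈ D'.carrier}) →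
      ∀ (Φ : ConformalEquiv (upperHalfPlaneSet \ A) upperHalfPlaneSet) (z w : ℂ),
        z ∈ D'.carrier → w ∈ D'.carrier → z ≠ w →
        Tendsto (fun δ => T D'.carrier δ (nearestSite δ z) (nearestSite δ w) /
            T D.carrier δ (nearestSite δ z) (nearestSite δ w)) (𝓝[>] 0)
          (𝓝 (twoPointFreeCHI (fun x => Φ (φ.symm x)) z w / twoPointFreeCHI (fun x => φ.symm x) z w)))
    (hK3 : ∀ (D D' : DobrushinDomain), D'.carrier ⊆ D.carrier → D'.pt 0 = D.pt 0 → D'.pt 1 = D.pt 1 →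
      (∃ ε : ℝ, 0 < ε ∧ D'.carrier ∩ Metric.ball (D.pt 0) ε = D.carrier ∩ Metric.ball (D.pt 0) ε ∧
        D'.carrier ∩ Metric.ball (D.pt 1) ε = D.carrier ∩ Metric.ball (D.pt 1) ε) →
      ∀ (φ : ConformalEquiv upperHalfPlaneSet D.carrier), D.IsChordalUniformizing φ →
      ∀ (A : Set ℂ), A = closure (upperHalfPlaneSet \ {z | z ∈ upperHalfPlaneSet ∧ φ z ∈ D'.carrier}) →
      ∀ (Φ : ConformalEquiv (upperHalfPlaneSet \ A) upperHalfPlaneSet) (d : ℝ),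
        IsRestrictionMap A Φ → HasRestrictionDeriv A Φ d →
        Tendsto (fun p : ℂ × ℂ => twoPointFreeCHI (fun x => Φ (φ.symm x)) p.1 p.2 /
            twoPointFreeCHI (fun x => φ.symm x) p.1 p.2)
          (𝓝[D'.carrier] (D.pt 0) ×ˢ 𝓝[D'.carrier] (D.pt 1)) (𝓝 (d ^ ((1 : ℝ) / 2)))) :
    NormalForm := by
  intro D D' a b hD hD' hsub h0 h1 hε φ hφ A hA Φ d hΦ hd
  rw [Metric.tendsto_nhds]
  intro e he
  have he3 : 0 < e / 3 := by positivity
  obtain ⟨r, hr, H1⟩ := hK1 D D' a b hD hD' hsub hε (e / 3) he3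
  have H3 := hK3 D D' hsub h0 h1 hε φ hφ A hA Φ d hΦ hd
  have hab : D.pt 0 ≠ D.pt 1 := fun h => absurd (D.pt_injective h) (by decide)
  set L := dist (D.pt 0) (D.pt 1) with hLdef
  have hL0 : 0 < L := dist_pos.2 hab
  have hcl0 : D.pt 0 ∈ closure D'.carrier := h0 ▸ frontier_subset_closure (D'.pt_mem_frontier 0)
  have hcl1 : D.pt 1 ∈ closure D'.carrier := h1 ▸ frontier_subset_closure (D'.pt_mem_frontier 1)
  haveI i0 : (𝓝[D'.carrier] (D.pt 0)).NeBot := mem_closure_iff_nhdsWithin_neBot.1 hcl0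
  haveI i1 : (𝓝[D'.carrier] (D.pt 1)).NeBot := mem_closure_iff_nhdsWithin_neBot.1 hcl1
  haveI : (𝓝[D'.carrier] (D.pt 0) ×ˢ 𝓝[D'.carrier] (D.pt 1)).NeBot := prod_neBot.2 ⟨i0, i1⟩
  have hρ0 : 0 < min r (L / 2) := lt_min hr (half_pos hL0)
  have ev1 : ∀ᶠ p : ℂ × ℂ in 𝓝[D'.carrier] (D.pt 0) ×ˢ 𝓝[D'.carrier] (D.pt 1),
      p.1 ∈ D'.carrier ∩ ball (D.pt 0) (min r (L / 2)) :=
    tendsto_fst.eventually (inter_mem self_mem_nhdsWithin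
      (mem_nhdsWithin_of_mem_nhds (ball_mem_nhds _ hρ0)))
  have ev2 : ∀ᶠ p : ℂ × ℂ in 𝓝[D'.carrier] (D.pt 0) ×ˢ 𝓝[D'.carrier] (D.pt 1),
      p.2 ∈ D'.carrier ∩ ball (D.pt 1) (min r (L / 2)) :=
    tendsto_snd.eventually (inter_mem self_mem_nhdsWithin
      (mem_nhdsWithin_of_mem_nhds (ball_mem_nhds _ hρ0)))
  have ev3 := Metric.tendsto_nhds.1 H3 _ he3
  obtain ⟨p, ⟨hz, hzρ⟩, ⟨hw, hwρ⟩, h3⟩ := (ev1.and (ev2.and ev3)).exists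
  rw [mem_ball] at hzρ hwρ
  have hzr : dist p.1 (D.pt 0) < r := lt_of_lt_of_le hzρ (min_le_left _ _)
  have hwr : dist p.2 (D.pt 1) < r := lt_of_lt_of_le hwρ (min_le_left _ _)
  have hne : p.1 ≠ p.2 := by
    intro hzw
    have h1' : dist p.1 (D.pt 0) < L / 2 := lt_of_lt_of_le hzρ (min_le_right _ _)
    have h2' : dist p.2 (D.pt 1) < L / 2 := lt_of_lt_of_le hwρ (min_le_right _ _)
    rw [hzw] at h1'
    have := dist_triangle_left (D.pt 0) (D.pt 1) p.2
    linarith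
  have H2 := hK2 D D' hsub φ A hA Φ p.1 p.2 hz hw hne
  have ev4 := Metric.tendsto_nhds.1 H2 _ he3
  filter_upwards [H1 p.1 p.2 hz hw hzr hwr, ev4] with δ hδ1 hδ2
  unfold ratio
  rw [Real.dist_eq] at hδ2 h3 ⊢
  have t1 := abs_sub_le (T D'.carrier δ (a δ) (b δ) / T D.carrier δ (a δ) (b δ))
    (T D'.carrier δ (nearestSite δ p.1) (nearestSite δ p.2) /
      T D.carrier δ (nearestSite δ p.1) (nearestSite δ p.2)) (d ^ ((1 : ℝ) / 2))
  have t2 := abs_sub_le (T D'.carrier δ (nearestSite δ p.1) (nearestSite δ p.2) /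
      T D.carrier δ (nearestSite δ p.1) (nearestSite δ p.2))
    (twoPointFreeCHI (fun x => Φ (φ.symm x)) p.1 p.2 / twoPointFreeCHI (fun x => φ.symm x) p.1 p.2)
    (d ^ ((1 : ℝ) / 2))
  linarith

/-- **Bulk free ratio + boundary fusion + the crux's normal form ⇒ anchor transfer** (NECESSITY of
the line's residual stub): produce conformal data `(φ, A, Φ, d)` for the pair `D' ⊆ D` — a chordal
uniformizer of `D`, the pulled-back `*`-hull `A = closure (ℍ ∖ φ⁻¹ D')` (`IsStarHull.pullbackHull`
through `isHullSubdomain_of_conds`; the marked points agree by `pt_eq_of_isEndpointApprox`), its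
restriction map and derivative (all exist by tree theorems) —, read off from boundary fusion a radius
`r` on which the continuum ratio is within `η/3` of `d^{1/2}`, and compare along `δ → 0⁺` the crux's
ratio (→ `d^{1/2}`) with the bulk lattice ratio at `(z, w)` (→ the continuum ratio). -/
theorem anchorTransfer_of_normalForm'
    (hK2 : ∀ (D D' : DobrushinDomain), D'.carrier ⊆ D.carrier →
      ∀ (φ : ConformalEquiv upperHalfPlaneSet D.carrier) (A : Set ℂ),
        A = closure (upperHalfPlaneSet \ {z | z ∈ upperHalfPlaneSet ∧ φ z ∈ D'.carrier}) →
      ∀ (Φ : ConformalEquiv (upperHalfPlaneSet \ A) upperHalfPlaneSet) (z w : ℂ),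
        z ∈ D'.carrier → w ∈ D'.carrier → z ≠ w →
        Tendsto (fun δ => T D'.carrier δ (nearestSite δ z) (nearestSite δ w) /
            T D.carrier δ (nearestSite δ z) (nearestSite δ w)) (𝓝[>] 0)
          (𝓝 (twoPointFreeCHI (fun x => Φ (φ.symm x)) z w / twoPointFreeCHI (fun x => φ.symm x) z w)))
    (hK3 : ∀ (D D' : DobrushinDomain), D'.carrier ⊆ D.carrier → D'.pt 0 = D.pt 0 → D'.pt 1 = D.pt 1 →
      (∃ ε : ℝ, 0 < ε ∧ D'.carrier ∩ Metric.ball (D.pt 0) ε = D.carrier ∩ Metric.ball (D.pt 0) ε ∧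
        D'.carrier ∩ Metric.ball (D.pt 1) ε = D.carrier ∩ Metric.ball (D.pt 1) ε) →
      ∀ (φ : ConformalEquiv upperHalfPlaneSet D.carrier), D.IsChordalUniformizing φ →
      ∀ (A : Set ℂ), A = closure (upperHalfPlaneSet \ {z | z ∈ upperHalfPlaneSet ∧ φ z ∈ D'.carrier}) →
      ∀ (Φ : ConformalEquiv (upperHalfPlaneSet \ A) upperHalfPlaneSet) (d : ℝ),
        IsRestrictionMap A Φ → HasRestrictionDeriv A Φ d →
        Tendsto (fun p : ℂ × ℂ => twoPointFreeCHI (fun x => Φ (φ.symm x)) p.1 p.2 /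
            twoPointFreeCHI (fun x => φ.symm x) p.1 p.2)
          (𝓝[D'.carrier] (D.pt 0) ×ˢ 𝓝[D'.carrier] (D.pt 1)) (𝓝 (d ^ ((1 : ℝ) / 2))))
    (h : NormalForm) :
    ∀ (D D' : DobrushinDomain) (a b : ℝ → Site 2), SAW.IsEndpointApprox D a b →
      SAW.IsEndpointApprox D' a b → D'.carrier ⊆ D.carrier →
      (∃ ε : ℝ, 0 < ε ∧ D'.carrier ∩ Metric.ball (D.pt 0) ε = D.carrier ∩ Metric.ball (D.pt 0) ε ∧
        D'.carrier ∩ Metric.ball (D.pt 1) ε = D.carrier ∩ Metric.ball (D.pt 1) ε) →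
      ∀ η : ℝ, 0 < η → ∃ r : ℝ, 0 < r ∧ ∀ z w : ℂ, z ∈ D'.carrier → w ∈ D'.carrier →
        dist z (D.pt 0) < r → dist w (D.pt 1) < r →
        ∀ᶠ δ in 𝓝[>] (0 : ℝ),
          |T D'.carrier δ (a δ) (b δ) / T D.carrier δ (a δ) (b δ) -
            T D'.carrier δ (nearestSite δ z) (nearestSite δ w) /
              T D.carrier δ (nearestSite δ z) (nearestSite δ w)| < η := by
  intro D D' a b hD hD' hsub hε η hη
  obtain ⟨h0, h1⟩ := pt_eq_of_isEndpointApprox hD hD'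
  -- conformal data for the pair `D' ⊆ D`
  obtain ⟨φ, hφ⟩ := MarkedDomain.exists_isChordalUniformizing_holds D
  set A : Set ℂ := closure (upperHalfPlaneSet \ {z | z ∈ upperHalfPlaneSet ∧ φ z ∈ D'.carrier})
    with hA
  have hHull : D.IsHullSubdomain D' := isHullSubdomain_of_conds hsub h0 h1 hε
  have hstar : IsStarHull A := by
    rw [hA]
    exact IsStarHull.pullbackHull JordanDomain.isSimplyConnected_holds hφ hHull
  obtain ⟨Φ, hΦ, -⟩ := IsStarHull.existsUnique_isRestrictionMap_holds hstar
  obtain ⟨d, -, -, hd⟩ := IsStarHull.exists_hasRestrictionDeriv_holds hstar hΦ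
  have H := h D D' a b hD hD' hsub h0 h1 hε φ hφ A hA Φ d hΦ hd
  have H3 := hK3 D D' hsub h0 h1 hε φ hφ A hA Φ d hΦ hd
  have he3 : 0 < η / 3 := by positivity
  -- a uniform radius from boundary fusion
  have ev3 := Metric.tendsto_nhds.1 H3 _ he3
  rw [Filter.eventually_prod_iff] at ev3
  obtain ⟨pa, hpa, pb, hpb, hp⟩ := ev3
  rw [eventually_nhdsWithin_iff, Metric.eventually_nhds_iff] at hpa hpb
  obtain ⟨ra, hra, Ha⟩ := hpa
  obtain ⟨rb, hrb, Hb⟩ := hpb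
  have hab : D.pt 0 ≠ D.pt 1 := fun h => absurd (D.pt_injective h) (by decide)
  set L := dist (D.pt 0) (D.pt 1) with hLdef
  have hL0 : 0 < L := dist_pos.2 hab
  refine ⟨min (min ra rb) (L / 2), lt_min (lt_min hra hrb) (half_pos hL0), ?_⟩
  intro z w hz hw hzr hwr
  have hza : dist z (D.pt 0) < ra := lt_of_lt_of_le hzr ((min_le_left _ _).trans (min_le_left _ _))
  have hwb : dist w (D.pt 1) < rb := lt_of_lt_of_le hwr ((min_le_left _ _).trans (min_le_right _ _))
  have hne : z ≠ w := by
    intro hzw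
    have h1' : dist z (D.pt 0) < L / 2 := lt_of_lt_of_le hzr (min_le_right _ _)
    have h2' : dist w (D.pt 1) < L / 2 := lt_of_lt_of_le hwr (min_le_right _ _)
    rw [hzw] at h1'
    have := dist_triangle_left (D.pt 0) (D.pt 1) w
    linarith
  have h3 : dist (twoPointFreeCHI (fun x => Φ (φ.symm x)) z w / twoPointFreeCHI (fun x => φ.symm x) z w)
      (d ^ ((1 : ℝ) / 2)) < η / 3 := hp (Ha hza hz) (Hb hwb hw)
  have H2 := hK2 D D' hsub φ A hA Φ z w hz hw hne
  have ev4 := Metric.tendsto_nhds.1 H2 _ he3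
  have evQ := Metric.tendsto_nhds.1 H _ he3
  filter_upwards [ev4, evQ] with δ h4 hQ
  unfold ratio at hQ
  rw [Real.dist_eq] at h3 h4 hQ
  rw [abs_sub_comm] at h4
  have t1 := abs_sub_le (T D'.carrier δ (a δ) (b δ) / T D.carrier δ (a δ) (b δ)) (d ^ ((1 : ℝ) / 2))
    (T D'.carrier δ (nearestSite δ z) (nearestSite δ w) / T D.carrier δ (nearestSite δ z) (nearestSite δ w))
  have t2 := abs_sub_le (d ^ ((1 : ℝ) / 2))
    (twoPointFreeCHI (fun x => Φ (φ.symm x)) z w / twoPointFreeCHI (fun x => φ.symm x) z w)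
    (T D'.carrier δ (nearestSite δ z) (nearestSite δ w) / T D.carrier δ (nearestSite δ z) (nearestSite δ w))
  rw [abs_sub_comm] at h3
  linarith

/-- **The residual stub of line `fk-anchor-transfer` is crux-equivalent modulo CHI's printed
theorem**: given the named fact `chi_twoPoint_free_jordan` (CHI15 Thm 1.1, free boundary conditions),
`IsingBoundaryRatio ↔ AnchorTransfer`. Sufficiency is the skeleton's composition
(`normalForm_of_anchorTransfer'` with the landed `bulkFreeRatio_of_chi` and
`stub_boundaryFusionCore stub_restrictionMapAtZero (stub_restrictionMapAtInfty stub_restrictionMapAtZero)`,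
through `isingBoundaryRatio_iff_normalForm`); necessity is `anchorTransfer_of_normalForm'`. -/
theorem isingBoundaryRatio_iff_anchorTransfer :
    Literature.Probability.LatticeModels.chi_twoPoint_free_jordan →
    (Summit.CriticalPhenomena.SAWScalingLimit.Theses.SAWLoopFugacityFlow.IsingBoundaryRatio ↔ ∀ (D
    D' : DobrushinDomain) (a b : ℝ → Site 2), SAW.IsEndpointApprox D a b → SAW.IsEndpointApprox D' a
    b → D'.carrier ⊆ D.carrier → (∃ ε : ℝ, 0 < ε ∧ D'.carrier ∩ Metric.ball (D.pt 0) ε = D.carrier ∩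
    Metric.ball (D.pt 0) ε ∧ D'.carrier ∩ Metric.ball (D.pt 1) ε = D.carrier ∩ Metric.ball (D.pt 1)
    ε) → ∀ η : ℝ, 0 < η → ∃ r : ℝ, 0 < r ∧ ∀ z w : ℂ, z ∈ D'.carrier → w ∈ D'.carrier → dist z (D.pt
    0) < r → dist w (D.pt 1) < r → ∀ᶠ δ in 𝓝[>] (0 : ℝ), |T D'.carrier δ (a δ) (b δ) / T D.carrier δ
    (a δ) (b δ) - T D'.carrier δ (nearestSite δ z) (nearestSite δ w) / T D.carrier δ (nearestSite δ
    z) (nearestSite δ w)| < η)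
    := fun hX =>
  ⟨fun h => anchorTransfer_of_normalForm' (bulkFreeRatio_of_chi hX)
      (stub_boundaryFusionCore stub_restrictionMapAtZero (stub_restrictionMapAtInfty stub_restrictionMapAtZero))
      (isingBoundaryRatio_iff_normalForm.1 h),
    fun hK1 => isingBoundaryRatio_iff_normalForm.2 (normalForm_of_anchorTransfer' hK1 (bulkFreeRatio_of_chi hX)
      (stub_boundaryFusionCore stub_restrictionMapAtZero (stub_restrictionMapAtInfty stub_restrictionMapAtZero)))⟩

end Summit.CriticalPhenomena.SAWScalingLimit.Theorems.IsingBoundaryRatio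

end
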